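import Summits.BirchSwinnertonDyer.BirchSwinnertonDyer.Theorems.KatoDescentPotSupersingularWildUpperDefectBillCount
import Summits.BirchSwinnertonDyer.BirchSwinnertonDyer.Theorems.KatoDescentPotSupersingularWildFineSelmerSupersingularUnitAnchor
import HarnessLib

/-!
# Route `KatoDescentPotSupersingular` (rung K9, cell `bsd-potss`): the U₀ BILL of item
# stmt-BirchSwinnertonDyer-19197 `WildUpperDefectRankZero` with FIVE anchor currencies — g4's bill v2
# (p458646) plus the two SUPERSINGULAR anchor roads of this seat (CM / Pollack–Rubin, p467612; unit data /
# Kobayashi 1.2 + B. D. Kim 3.15) made usable by the "± ⊇ fine" bridge (p466275)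
# (a `--supports … --as helper` file; seat `bsd-potss-k9-c4` g5; ROUTE-FREE; nothing booked, BSD is not
# proved by any of this, the item is NOT closed)

WHY. After g4 the exact residue of item 19197 is ONE anchor certificate per ♯ row of the Conj-A crux
19386 (irreducible `W[3]`, 3-adic tower not onto, `3 ∣ ∏ c_ℓ` or no Manin-clean datum, non-CM), in one
of three currencies: (A) at a congruent `W′`, finite `Sel_{3^∞}(W′/ℚ^cyc)[3]`, or Greenberg's ordinary
unit data (bill v2, `WildUpperDefectBillCount.wildUpperDefectRankZero_bill_of_countInputs_of_anchors`).
The ordinary currencies reach the 3Ns rows (3 split in the Cartan field); on the 3Nn rows (95 of the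
163 ♯ rows) every anchor is SUPERSINGULAR at `3`. This seat's bridge `Sel₀ ≤ Sel^ε` (p466275) and the
two roads built on it add two supersingular currencies, recorded here as the bill v3:
(4) a congruent globally minimal `W′` good supersingular at `3` with `a₃ = 0` and the THREE integers
`rank E′(ℚ) = 0`, `#Ш(E′)[3^∞] = 1`, `3 ∤ ∏ c_ℓ(E′)` (Kobayashi 1.2 `h12` + Kim 3.15 `hKim`;
`WildFineSelmerSupersingularUnitAnchor.conjA_rat_of_signedUnitData`), CM or not; (5) a congruent CM `W′`
good supersingular at `3` with a newform `f`, `ϖ·Ω = Ω⁺_f`, a Pollack pair and ONE unit coefficient of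
`ϖ·L^{∓}` for a sign `ε` (Pollack–Rubin `hPR`; `WildFineSelmerSupersingularCMAnchor.conjA_rat_of_pollackRubin`).
Both are mapped into currency (1) and bill v2 is applied verbatim — `wildUpperDefectRankZero_bill_of_fiveCurrencies`.
Against the route decls the conclusion is the BODY of `WildUpperDefectRankZero` (the file does not import
the route, so that `closes` may use it); `h₂`/`hR` are the bodies of L₀ (`WildLowerHalfRankZero`) and
R₁ (`WildRankOne`).

HONEST FRAMING: conditional-result on the displayed named facts (all published theorems typed in the
tree; no new fact); the per-row data are hypotheses (census data of record, not kernel inputs); item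
19197 is NOT closed (it is a derived support; it closes only with 19189/19190/19191); class-wide the open
content is Coates–Sujatha (A) on the ♯ rows (crux 19386, a named open problem).
References: [Kato2004Asterisque] Thm. 14.5 (3), Prop. 14.16 (2); [LimSujatha2018] §3 Prop. 3.2;
[GreenbergLNM1716] §4 Thm. 4.1; [Kobayashi2003] Thm. 1.2; [BDKim2013] Cor. 3.15; [PollackRubin2004]
Theorem (p. 448); [MatarNekovar2019] Thm. 0.3.
-/

set_option autoImplicit false
-- sibling precedent (`KatoDescentPotSupersingularAssembly.lean`): the directory name repeats the summit name
set_option linter.dupNamespace false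

noncomputable section

open scoped Classical MatrixGroups ModularForm

namespace Summit.BirchSwinnertonDyer.BirchSwinnertonDyer.Theorems.WildUpperDefectBillSigned

open CongruenceSubgroup WeierstrassCurve Literature.NumberTheory.EllipticCurves
  Literature.NumberTheory.EllipticCurves.ModularForms
  Literature.NumberTheory.EllipticCurves.Rank1Residual
  Literature.NumberTheory.EllipticCurves.Rank1Residual.Typed
  Literature.NumberTheory.EllipticCurves.Kobayashi2003
  Summit.BirchSwinnertonDyer.Rank1Residual Summit.BirchSwinnertonDyer.Rank1Residual.Additive
  Summit.BirchSwinnertonDyer.Rank1Residual.O6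
  Summit.BirchSwinnertonDyer.BirchSwinnertonDyer.Theorems

/-- **THE U₀ BILL v3 (item 19197): five anchor currencies.** As bill v2 (`hGZ … hin`, `h₂`, `hR`)
plus Kobayashi's Thm. 1.2 (`h12`), B. D. Kim's Cor. 3.15 (`hKim`) and Pollack–Rubin (`hPR`); per
irreducible tower-deficient ♯ non-CM row ONE globally minimal `W′` with `W′[3] ≃ W[3]` and ONE of:
(1) (A) at `(W′,3)` for every cyclotomic datum; (2) finite `Sel_{3^∞}(W′/ℚ^cyc)[3]` for every cyclotomic
datum; (3) Greenberg unit data (good ordinary at `3`, `rank = 0`, `#Ш[3^∞] = 1`, `3 ∤ #tors·Tam·#Ẽ′(𝔽₃)`);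
(4) SUPERSINGULAR unit data (good at `3`, `a₃ = 0`, `rank = 0`, `#Ш[3^∞] = 1`, `3 ∤ Tam`);
(5) CM good supersingular at `3` with a newform, `ϖ·Ω = Ω⁺_f`, a Pollack pair at `3`, a sign `ε` and a
`3`-adic unit coefficient of `ϖ·L^{∓}`. Conclusion: the BODY of `WildUpperDefectRankZero`. Conditional;
the item is NOT closed. [cite: Kato2004Asterisque, Thm. 14.5 (3) (p. 236), Prop. 14.16 (2) (p. 244)]
[cite: Kobayashi2003, Thm. 1.2] [cite: BDKim2013, Cor. 3.15 (p. 199)] [cite: PollackRubin2004, Theorem (p. 448)]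
[cite: LimSujatha2018, §3 Prop. 3.2] [cite: GreenbergLNM1716, §4 Thm. 4.1 (p. 85)] -/
theorem wildUpperDefectRankZero_bill_of_fiveCurrencies
    (hGZ : ∀ (N : ℕ) [NeZero N] (W : WeierstrassCurve ℚ) (K : Type) [Field K] [NumberField K],
      gross_zagier N W K)
    (hKo : ∀ (N : ℕ) [NeZero N] (W : WeierstrassCurve ℚ) (K : Type) [Field K] [NumberField K],
      kolyvagin N W K)
    (hMN : ∀ (N : ℕ) [NeZero N] (W : WeierstrassCurve ℚ) (K : Type) [Field K] [NumberField K],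
      MatarNekovar2019.thm03_padicValNat_card_sha_le_of_irreducible N W K)
    (hnf : exists_isNewformOf) (hBFH : bumpFriedbergHoffstein_exists_heegnerField_split_twist_simpleZero)
    (hK : Kato2004.rankZero_padicValNat_sha_add_padicValNat_tamagawa_le_of_additive_potGood_of_imageContainsSL2 ∧
      rank_eq_analyticRank_of_analyticRank_le_one ∧ WeierstrassCurve.hasEntireLFunction_rat)
    (hF : Kato2004.rankZero_padicValNat_sha_add_padicValNat_tamagawa_le_of_additive_potGood_of_irreducible_of_fineSelmerDual_fg ∧
      bsdTriple_of_hasCM_of_L_one_ne_zero)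
    (hCassels : bsdRHS_eq_of_isIsogenous)
    (hLS : LimSujatha2018.prop32_fineSelmerDual_moduleFinite_iff_of_torsionIso)
    (hPRS : Schneider1985_order_charGenerator_odd)
    (h12 : Kobayashi2003.thm12_signedSelmerDual_finite_torsion)
    (hKim : BDKim2013.cor315_signedCharValue_rankZero)
    (hPR : PollackRubin2004.mainTheorem_signedCharIdeal_eq_of_cm)
    (hne : Kato2004.nonempty_iwasawaH1Data) (hin : Kato2004.exists_memberHullCountInputs)
    (h₂ : ∀ (W : WeierstrassCurve ℚ) [W.IsElliptic] [W.IsGloballyMinimal] [Fact (3 : ℕ).Prime],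
      W.analyticRank = 0 → ClassO6 W 3 → MissingLowerBoundAt W 3)
    (hR : ∀ (W : WeierstrassCurve ℚ) [W.IsElliptic] [W.IsGloballyMinimal] [Fact (3 : ℕ).Prime],
      W.analyticRank = 1 → ClassO6 W 3 → MissingPPartAt W 3)
    (hcert : ∀ (W : WeierstrassCurve ℚ) [W.IsElliptic] [W.IsGloballyMinimal] [Fact (3 : ℕ).Prime],
      W.analyticRank = 0 → ClassO6 W 3 → W.HasIrreducibleModPGaloisRep 3 →
      ¬ (∀ n : ℕ, W.HasSurjectiveModNGaloisRep (3 ^ n : ℕ)) →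
      (3 ∣ W.tamagawaProduct ∨ ∀ [NeZero (W.conductorNorm ℤ)]
        (D : ModularParametrizationData W (W.conductorNorm ℤ)), (3 : ℤ) ∣ D.maninConstant) →
      ¬ W.HasCM →
      ∃ (W' : WeierstrassCurve ℚ) (_ : W'.IsElliptic) (_ : W'.IsGloballyMinimal), ModPCongruent W' W 3 ∧
        ((∀ (κ : ZpExtension ℚ 3), κ.IsCyclotomic →
            ∃ (γ : Field.absoluteGaloisGroup ℚ) (D : W'.FineSelmerDualData κ γ),
              Module.Finite ℤ_[3] (RestrictScalars ℤ_[3] (IwasawaAlgebra 3) D.X)) ∨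
          (∀ (κ : ZpExtension ℚ 3), κ.IsCyclotomic → Set.Finite {s : W'.selmerInfty κ | 3 • s = 0}) ∨
          (W'.HasGoodReductionAtPrime 3 ∧ ¬ (3 : ℤ) ∣ W'.frobeniusTrace 3 ∧ W'.mordellWeilRank = 0 ∧
            Nat.card (AddCommGroup.primaryComponent W'.sha 3) = 1 ∧ ¬ 3 ∣ W'.torsionOrder ∧
            ¬ 3 ∣ W'.tamagawaProduct ∧ ¬ 3 ∣ W'.reductionPointCount 3) ∨
          (W'.HasGoodReductionAtPrime 3 ∧ W'.frobeniusTrace 3 = 0 ∧ W'.mordellWeilRank = 0 ∧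
            Nat.card (AddCommGroup.primaryComponent W'.sha 3) = 1 ∧ ¬ 3 ∣ W'.tamagawaProduct) ∨
          (W'.HasCM ∧ GoodSS W' 3 ∧ ∃ (ε : ℤˣ) (_ : NeZero (W'.conductorNorm ℤ))
              (f : CuspForm (Gamma0 (W'.conductorNorm ℤ)) 2) (ϖ : ℚ) (Lplus Lminus : IwasawaAlgebra 3),
            IsNewformOf W' f ∧ (ϖ : ℝ) * W'.realPeriodRat = plusPeriod f ∧
            Supersingular.IsPollackPair f 3 Lplus Lminus ∧
            ∃ k : ℕ, ‖(ϖ : ℚ_[3]) *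
              PowerSeries.coeff k (iwasawaToPowerSeries 3 (if ε = 1 then Lminus else Lplus))‖ = 1))) :
    ∀ (W : WeierstrassCurve ℚ) [W.IsElliptic] [W.IsGloballyMinimal] [Fact (3 : ℕ).Prime],
      W.analyticRank = 0 → ClassO6 W 3 →
      ¬ (((∀ n : ℕ, W.HasSurjectiveModNGaloisRep (3 ^ n : ℕ)) ∧ ¬ 3 ∣ W.tamagawaProduct ∧
            ∃ (N : ℕ) (_ : NeZero N) (D : ModularParametrizationData W N), ¬ (3 : ℤ) ∣ D.maninConstant) ∨
        (¬ W.HasIrreducibleModPGaloisRep 3 ∧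
          (∀ (W' : WeierstrassCurve ℚ) [W'.IsElliptic], IsIsogenous W W' → ¬ 3 ^ 2 ∣ W'.torsionOrder) ∧
          ∀ q : ℚ, shaAn W = (q : ℂ) → Even (padicValRat 3 q))) →
      MissingUpperBoundAt W 3 := by
  refine WildUpperDefectBillCount.wildUpperDefectRankZero_bill_of_countInputs_of_anchors hGZ hKo hMN hnf
    hBFH hK hF hCassels hLS hPRS hne hin h₂ hR fun W _ _ _ hr hO hirr hns hsharp hcm ↦ ?_
  obtain ⟨W', hW', hW'min, hcong, h1 | h2 | h3 | h4 | h5⟩ := hcert W hr hO hirr hns hsharp hcm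
  · exact ⟨W', hW', hW'min, hcong, Or.inl h1⟩
  · exact ⟨W', hW', hW'min, hcong, Or.inr (Or.inl h2)⟩
  · exact ⟨W', hW', hW'min, hcong, Or.inr (Or.inr h3)⟩
  · -- (4) supersingular unit data ⟹ (A) at `(W′,3)`
    haveI := hW'
    haveI := hW'min
    obtain ⟨hgood', hap', hrank', hsha', htam'⟩ := h4
    exact ⟨W', hW', hW'min, hcong, Or.inl
      (WildFineSelmerSupersingularUnitAnchor.conjA_rat_of_signedUnitData h12 hKim W' (by norm_num) hgood'
        hap' hrank' hsha' htam')⟩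
  · -- (5) CM good supersingular + Pollack–Rubin + unit coefficient ⟹ (A) at `(W′,3)`
    haveI := hW'
    haveI := hW'min
    obtain ⟨hcm', hss', ε, hN, f, ϖ, Lplus, Lminus, hf, hϖ, hL, hunit⟩ := h5
    haveI := hN
    exact ⟨W', hW', hW'min, hcong, Or.inl
      (WildFineSelmerSupersingularCMAnchor.conjA_rat_of_pollackRubin hPR W' hcm' (by norm_num) hss' ε f
        hf ϖ hϖ Lplus Lminus hL hunit)⟩

end Summit.BirchSwinnertonDyer.BirchSwinnertonDyer.Theorems.WildUpperDefectBillSigned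

end
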